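import Mathlib
import Summits.ValiantsHypothesis.ValiantsHypothesis.Theorems.DualUnipotentThreeHalves.Negative.FlagCheapIndexBound
import Summits.ValiantsHypothesis.ValiantsHypothesis.Theorems.DualUnipotentThreeHalves.Negative.FlagCheapOfTriangularisable

/-!
# Short tops make a pencil flag-cheap (SUF: run-length flags)

Negative-lane record for crux `GrenetZeon.DualUnipotentThreeHalves` (stmt-ValiantsHypothesis-24318), lines
`flag_cost` (S3b `FlagCostLaw`) and `radical_split` (R2 `HeavyTopLaw`).

`FlagCheapIndexBound` proved the NECESSARY half of the sandwich: a flag of budget `k` on the line `x + s v`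
kills every word with `> k` linear letters, so `FlagCheap n m N` forces `N_lin(v)^{k+1} = 0` on a direction space
`K` with `(k+1)·n < dim K` (`linPart_pow_eq_zero_of_flagCheap`).  This file proves the SUFFICIENT half:

* `exists_conj_adapted_of_pow_eq_zero` — linear algebra: if `A ^ ν = 0` (`ν ≥ 1`) there are `g ∈ GL_m(ℂ)` and
  levels `lvl : Fin m → ℕ`, all `< ν`, with `(g A g⁻¹) i j ≠ 0 → lvl j + 1 ≤ lvl i` (a basis adapted to the image
  flag `ℂ^m ⊇ Im A ⊇ Im A² ⊇ ⋯ ⊇ Im A^ν = 0`, built by `LinearIndepOn.extend` from the bottom);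
* `flagCheap_of_top_pow_eq_zero` — **SUF**: if `N` is entrywise affine, `N_lin(v)^ν = 0` for all `v` in a
  subspace `K`, and `(⌊(ν-1)n/ν⌋ + 1)·n < dim K`, then `FlagCheap n m N` (unfolded verbatim as in
  `FlagCheapIndexBound`): on each line use the image flag of the top `N_lin(v)` with `p = ν`, `r = a = ν - 1`
  — the constant letter is unconstrained (`lvl j ≤ ν - 1 = r`), the linear letter climbs one level, there are no
  `s²`-coefficients, and `flagDeg ν (ν-1) (ν-1) n = ⌊(ν-1)n/ν⌋`;
* `flagCheap_of_top_index_lt` — corollary (`K = ⊤`): if EVERY top has nil-index `≤ ν < n` the pencil is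
  flag-cheap.  Consequently `FlagCostLaw` / `HeavyTopLaw` have content only for pencils whose generic top
  `N_lin(v)` has nil-index `≥ n` (nilpotency `N(x)^m = 0` of the pencil bounds top indices only by `m`).

So in the kernel:  «tops of index `≤ ν` on `K`, `(⌊(ν-1)n/ν⌋+1)n < dim K`»  ⇒  `FlagCheap n m N`  ⇒
«tops of index `≤ k+1` on some `K`, `(k+1)n < dim K`, `k+2 ≤ n`».  No summit statement is proved here; 24318 stays
OPEN.  Mathlib + the two landed Negative files only; no new definitions. [folklore]
-/

set_option linter.dupNamespace false
set_option autoImplicit false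

namespace Summit.ValiantsHypothesis.ValiantsHypothesis.Theorems.DualUnipotentThreeHalvesNegative.FlagCost

open MvPolynomial Submodule Module

/-- **Image flag of a nilpotent matrix.**  If `A ^ ν = 0` (`ν ≥ 1`) then in a basis adapted to the chain
`ℂ^m ⊇ Im A ⊇ Im A² ⊇ ⋯ ⊇ Im A^ν = 0` the conjugate `g A g⁻¹` is supported on pairs `(i, j)` with
`lvl j + 1 ≤ lvl i`, where `lvl i = max {ℓ : b_i ∈ Im A^ℓ} < ν`. -/
theorem exists_conj_adapted_of_pow_eq_zero {m : ℕ} (A : Matrix (Fin m) (Fin m) ℂ) (ν : ℕ) (hν : 1 ≤ ν)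
    (hA : A ^ ν = 0) :
    ∃ (g : (Matrix (Fin m) (Fin m) ℂ)ˣ) (lvl : Fin m → ℕ), (∀ i, lvl i < ν) ∧
      ∀ i j, ((g : Matrix (Fin m) (Fin m) ℂ) * A * (↑g⁻¹ : Matrix (Fin m) (Fin m) ℂ)) i j ≠ 0 →
        lvl j + 1 ≤ lvl i := by
  classical
  -- the image filtration `V ℓ = Im A^ℓ`
  obtain ⟨V, hV⟩ : ∃ V : ℕ → Submodule ℂ (Fin m → ℂ), ∀ ℓ, V ℓ = LinearMap.range (Matrix.toLin' (A ^ ℓ)) :=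
    ⟨_, fun _ => rfl⟩
  have hV0 : V 0 = ⊤ := by
    rw [hV, pow_zero, Matrix.toLin'_one]; exact LinearMap.range_id
  have hVν : V ν = ⊥ := by
    rw [hV, hA, map_zero]; exact LinearMap.range_zero
  have hstep : ∀ ℓ, ∀ u ∈ V ℓ, A.mulVec u ∈ V (ℓ + 1) := by
    intro ℓ u hu
    rw [hV] at hu ⊢
    obtain ⟨w, rfl⟩ := hu
    exact ⟨w, by simp [Matrix.toLin'_apply, pow_succ']⟩
  have hmono : ∀ ℓ, V (ℓ + 1) ≤ V ℓ := by
    intro ℓ u hu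
    rw [hV] at hu ⊢
    obtain ⟨w, rfl⟩ := hu
    exact ⟨A.mulVec w, by simp [Matrix.toLin'_apply, pow_succ]⟩
  have hanti : ∀ ℓ ℓ', ℓ ≤ ℓ' → V ℓ' ≤ V ℓ := by
    intro ℓ ℓ' h
    induction h with
    | refl => exact le_rfl
    | step _ ih => exact (hmono _).trans ih
  -- nested adapted independent sets, built from the bottom `V ν = 0` upwards
  have hQ : ∀ t, t ≤ ν → ∃ s : Set (Fin m → ℂ), LinearIndepOn ℂ id s ∧ s ⊆ (V (ν - t) : Set (Fin m → ℂ)) ∧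
      ∀ ℓ, ν - t ≤ ℓ → ℓ ≤ ν → (V ℓ : Set (Fin m → ℂ)) ⊆ span ℂ (s ∩ (V ℓ : Set (Fin m → ℂ))) := by
    intro t
    induction t with
    | zero =>
      intro _
      refine ⟨∅, linearIndepOn_empty ℂ id, Set.empty_subset _, ?_⟩
      intro ℓ h1 h2
      have hℓ : ℓ = ν := by omega
      subst hℓ
      intro u hu
      rw [SetLike.mem_coe, hVν, Submodule.mem_bot] at hu
      simp [hu]
    | succ t ih =>
      intro ht
      obtain ⟨s, hli, hsV, hspan⟩ := ih (by omega)
      have hst : s ⊆ (V (ν - (t + 1)) : Set (Fin m → ℂ)) :=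
        hsV.trans (hanti _ _ (by omega))
      refine ⟨hli.extend hst, hli.linearIndepOn_extend hst, hli.extend_subset hst, ?_⟩
      intro ℓ h1 h2
      rcases Nat.lt_or_ge ℓ (ν - t) with hlt | hge
      · have hℓ : ℓ = ν - (t + 1) := by omega
        subst hℓ
        intro u hu
        rw [Set.inter_eq_left.mpr (hli.extend_subset hst)]
        exact hli.subset_span_extend hst hu
      · intro u hu
        exact span_mono (Set.inter_subset_inter_left _ (hli.subset_extend hst)) (hspan ℓ hge h2 hu)
  obtain ⟨s, hli, -, hspan⟩ := hQ ν le_rfl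
  have htop : ⊤ ≤ span ℂ (Set.range (fun x : s => (x : Fin m → ℂ))) := by
    rw [Subtype.range_coe]
    intro u _
    have hu : u ∈ (V 0 : Set (Fin m → ℂ)) := by rw [SetLike.mem_coe, hV0]; trivial
    exact span_mono Set.inter_subset_left (hspan 0 (by omega) (by omega) hu)
  -- a basis of ℂ^m inside `s`, reindexed by `Fin m`
  let b₀ : Basis s ℂ (Fin m → ℂ) := Basis.mk hli htop
  haveI : Fintype s := FiniteDimensional.fintypeBasisIndex b₀
  let e : s ≃ Fin m := b₀.indexEquiv (Pi.basisFun ℂ (Fin m))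
  let b : Basis (Fin m) ℂ (Fin m → ℂ) := b₀.reindex e
  have hb : ∀ i, b i = ((e.symm i : s) : Fin m → ℂ) := by
    intro i; simp [b, b₀, Basis.reindex_apply, Basis.mk_apply]
  have hb_mem : ∀ i, b i ∈ s := fun i => by rw [hb]; exact (e.symm i).2
  -- coordinates of a vector of `V ℓ` live on basis vectors inside `V ℓ`
  have hb_repr : ∀ ℓ, ℓ ≤ ν → ∀ u ∈ V ℓ, ∀ i, b.repr u i ≠ 0 → b i ∈ V ℓ := by
    intro ℓ hℓ u hu i hi
    have hu' : u ∈ span ℂ (b '' {i | b i ∈ V ℓ}) := by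
      refine span_mono ?_ (hspan ℓ (by omega) hℓ hu)
      rintro w ⟨hws, hwV⟩
      refine ⟨e ⟨w, hws⟩, ?_, ?_⟩
      · show b (e ⟨w, hws⟩) ∈ V ℓ
        rw [hb, Equiv.symm_apply_apply]; exact hwV
      · rw [hb, Equiv.symm_apply_apply]
    have := b.repr_support_subset_of_mem_span _ hu'
    exact this (Finsupp.mem_support_iff.mpr hi)
  -- levels
  obtain ⟨lvl, hlvl⟩ : ∃ lvl : Fin m → ℕ, ∀ i,
      lvl i = ((Finset.range ν).filter fun ℓ => 1 ≤ ℓ ∧ b i ∈ V ℓ).card := ⟨_, fun _ => rfl⟩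
  have hnotν : ∀ i, b i ∉ V ν := by
    intro i hi
    rw [hVν, Submodule.mem_bot] at hi
    exact b.ne_zero i hi
  have hlt : ∀ i, lvl i < ν := by
    intro i
    rw [hlvl]
    calc ((Finset.range ν).filter fun ℓ => 1 ≤ ℓ ∧ b i ∈ V ℓ).card
        ≤ ((Finset.range ν).erase 0).card := by
          apply Finset.card_le_card
          intro ℓ hℓ
          simp only [Finset.mem_filter, Finset.mem_range] at hℓ
          simp only [Finset.mem_erase, Finset.mem_range]
          exact ⟨by omega, hℓ.1⟩
      _ < ν := by
          rw [Finset.card_erase_of_mem (Finset.mem_range.mpr (by omega)), Finset.card_range]; omega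
  have hge : ∀ i ℓ, 1 ≤ ℓ → ℓ ≤ ν → b i ∈ V ℓ → ℓ ≤ lvl i := by
    intro i ℓ h1 h2 hmem
    have hℓν : ℓ < ν := by
      rcases Nat.lt_or_ge ℓ ν with h | h
      · exact h
      · exact absurd (hanti _ _ h hmem) (hnotν i)
    rw [hlvl]
    calc ℓ = (Finset.Icc 1 ℓ).card := by simp
      _ ≤ _ := by
        apply Finset.card_le_card
        intro ℓ' hℓ'
        simp only [Finset.mem_Icc] at hℓ'
        simp only [Finset.mem_filter, Finset.mem_range]
        exact ⟨by omega, hℓ'.1, hanti _ _ hℓ'.2 hmem⟩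
  have hmem_lvl : ∀ i, b i ∈ V (lvl i) := by
    intro i
    by_contra hne
    have hpos : 1 ≤ lvl i := by
      rcases Nat.lt_or_ge (lvl i) 1 with h | h
      · exfalso; apply hne
        have : lvl i = 0 := by omega
        rw [this, hV0]; trivial
      · exact h
    have : lvl i ≤ lvl i - 1 := by
      conv_lhs => rw [hlvl i]
      calc ((Finset.range ν).filter fun ℓ => 1 ≤ ℓ ∧ b i ∈ V ℓ).card
          ≤ (Finset.Icc 1 (lvl i - 1)).card := by
            apply Finset.card_le_card
            intro ℓ' hℓ'
            simp only [Finset.mem_filter, Finset.mem_range] at hℓ'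
            simp only [Finset.mem_Icc]
            refine ⟨hℓ'.2.1, ?_⟩
            rcases Nat.lt_or_ge ℓ' (lvl i) with h | h
            · omega
            · exact absurd (hanti _ _ h hℓ'.2.2) hne
        _ = lvl i - 1 := by simp
    omega
  -- the change of basis
  obtain ⟨g, hgv, hgi⟩ : ∃ g : (Matrix (Fin m) (Fin m) ℂ)ˣ,
      (g : Matrix (Fin m) (Fin m) ℂ) = b.toMatrix (Pi.basisFun ℂ (Fin m)) ∧
      (↑g⁻¹ : Matrix (Fin m) (Fin m) ℂ) = (Pi.basisFun ℂ (Fin m)).toMatrix b :=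
    ⟨⟨b.toMatrix (Pi.basisFun ℂ (Fin m)), (Pi.basisFun ℂ (Fin m)).toMatrix b,
      b.toMatrix_mul_toMatrix_flip _, (Pi.basisFun ℂ (Fin m)).toMatrix_mul_toMatrix_flip b⟩, rfl, rfl⟩
  refine ⟨g, lvl, hlt, ?_⟩
  intro i j hij
  have hconj : b.toMatrix (Pi.basisFun ℂ (Fin m)) * A * (Pi.basisFun ℂ (Fin m)).toMatrix b =
      LinearMap.toMatrix b b (Matrix.toLin' A) := by
    conv_lhs => rw [show A = LinearMap.toMatrix (Pi.basisFun ℂ (Fin m)) (Pi.basisFun ℂ (Fin m))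
      (Matrix.toLin' A) by rw [LinearMap.toMatrix_eq_toMatrix', LinearMap.toMatrix'_toLin']]
    exact basis_toMatrix_mul_linearMap_toMatrix_mul_basis_toMatrix b (Pi.basisFun ℂ (Fin m)) b
      (Pi.basisFun ℂ (Fin m)) (Matrix.toLin' A)
  rw [hgv, hgi, hconj, LinearMap.toMatrix_apply, Matrix.toLin'_apply] at hij
  have h1 : A.mulVec (b j) ∈ V (lvl j + 1) := hstep _ _ (hmem_lvl j)
  have h2 : b i ∈ V (lvl j + 1) := hb_repr _ (hlt j) _ h1 i hij
  exact hge i _ (by omega) (hlt j) h2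


/-- **SUF — run-length flags make short-topped pencils flag-cheap.**  If along every direction `v`
of a subspace `K` the top `N_lin(v) = (∑_c v_c · coeff_{x_c} N_{ij})_{ij}` satisfies `N_lin(v)^ν = 0`
(`ν ≥ 1`) and `(⌊(ν-1)n/ν⌋ + 1)·n < dim K`, then the entrywise-affine pencil `N` is `FlagCheap n m N`
(conclusion displayed unfolded, cf. `indexCheap_of_flagCheap`): on the line `x + s v` take the image flag of
`N_lin(v)` (`exists_conj_adapted_of_pow_eq_zero`) with `p = ν`, `r = a = ν - 1`; the constant letter is then
unconstrained (`lvl j ≤ ν - 1 = r`), the linear letter climbs one level, and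
`flagDeg ν (ν-1) (ν-1) n = ⌊(ν-1)n/ν⌋`.  Together with `linPart_pow_eq_zero_of_flagCheap` (NEC: budget `k`
forces `N_lin(v)^{k+1} = 0` on `K`) this sandwiches `FlagCheap` between two index conditions. -/
theorem flagCheap_of_top_pow_eq_zero {n m : ℕ} (N : Matrix (Fin m) (Fin m) (MvPolynomial (Fin n × Fin n) ℂ))
    (hN : ∀ i j, (N i j).totalDegree ≤ 1) (K : Submodule ℂ (Fin n × Fin n → ℂ)) (ν : ℕ) (hν : 1 ≤ ν)
    (htop : ∀ v : Fin n × Fin n → ℂ, v ∈ K →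
      (Matrix.of fun i j => ∑ c, v c * coeff (Finsupp.single c 1) (N i j)) ^ ν = 0)
    (hbudget : ((ν - 1) * n / ν + 1) * n < Module.finrank ℂ K) :
    ∃ (K : Submodule ℂ (Fin n × Fin n → ℂ)) (k : ℕ),
      (∀ x v : Fin n × Fin n → ℂ, v ∈ K →
        ∃ (g : (Matrix (Fin m) (Fin m) ℂ)ˣ) (lvl : Fin m → ℕ) (p r a : ℕ),
          (∀ i, lvl i < p) ∧ (p - 1 + r * (n - 1)) / (a + 1) ≤ k ∧
          ∀ (i j : Fin m) (d : Fin 1 →₀ ℕ),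
            coeff d (((g : Matrix (Fin m) (Fin m) ℂ).map C *
              N.map (aeval fun c => (C (x c) + ∑ t : Fin 1, C (v c) * X t : MvPolynomial (Fin 1) ℂ)) *
              (↑g⁻¹ : Matrix (Fin m) (Fin m) ℂ).map C : Matrix (Fin m) (Fin m) (MvPolynomial (Fin 1) ℂ)) i j) ≠ 0 →
              (a + 1) * d 0 + lvl j ≤ lvl i + r) ∧
      (k + 1) * n < Module.finrank ℂ K := by
  classical
  refine ⟨K, (ν - 1) * n / ν, ?_, hbudget⟩
  intro x v hv
  obtain ⟨g, lvl, hlt, hadapt⟩ := exists_conj_adapted_of_pow_eq_zero _ ν hν (htop v hv)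
  refine ⟨g, lvl, ν, ν - 1, ν - 1, hlt, ?_, ?_⟩
  · -- the budget `flagDeg ν (ν-1) (ν-1) n = ⌊(ν-1)n/ν⌋`
    have h1 : ν - 1 + 1 = ν := by omega
    rw [h1]
    rcases Nat.eq_zero_or_pos n with rfl | hn
    · have h0 : (ν - 1 + (ν - 1) * (0 - 1)) / ν = 0 := Nat.div_eq_of_lt (by simp; omega)
      rw [h0]; exact Nat.zero_le _
    · have ht : ν - 1 ≤ (ν - 1) * n := Nat.le_mul_of_pos_right _ hn
      have h2 : ν - 1 + (ν - 1) * (n - 1) = (ν - 1) * n := by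
        rw [Nat.mul_sub_one]; omega
      rw [h2]
  · intro i j d hd
    have hd_eq : d = Finsupp.single 0 (d 0) := by
      ext; simp
    have hcases : d 0 = 0 ∨ d 0 = 1 ∨ 2 ≤ d 0 := by omega
    rcases hcases with h0 | h1 | h2
    · have := hlt j; have := hlt i; rw [h0]; omega
    · rw [hd_eq, h1, coeff_conj_apply, top_map_aeval_line_eq_linPart N hN x v] at hd
      have := hadapt i j hd
      rw [h1]; omega
    · exfalso; apply hd
      rw [coeff_conj_apply]
      have hz : (N.map (aeval fun c => (C (x c) + ∑ t : Fin 1, C (v c) * X t : MvPolynomial (Fin 1) ℂ))).map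
          (coeff d) = 0 := by
        ext i' j'
        simp only [Matrix.map_apply, Matrix.zero_apply]
        exact coeff_aeval_line_eq_zero_of_two_le _ (hN i' j') x v d h2
      rw [hz, Matrix.mul_zero, Matrix.zero_mul, Matrix.zero_apply]

/-- **Corollary — pencils all of whose tops have nil-index `< n` are flag-cheap** (`K = ⊤`,
`k = ⌊(ν-1)n/ν⌋ ≤ n - 2`).  Hence `FlagCostLaw` / `HeavyTopLaw` have content only for pencils whose generic
top `N_lin(v)` has nil-index `≥ n` (while `N(x)^m = 0` forces nothing on the tops beyond index `≤ m`). -/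
theorem flagCheap_of_top_index_lt {n m : ℕ} (N : Matrix (Fin m) (Fin m) (MvPolynomial (Fin n × Fin n) ℂ))
    (hN : ∀ i j, (N i j).totalDegree ≤ 1) (ν : ℕ) (hν : 1 ≤ ν) (hνn : ν < n)
    (htop : ∀ v : Fin n × Fin n → ℂ,
      (Matrix.of fun i j => ∑ c, v c * coeff (Finsupp.single c 1) (N i j)) ^ ν = 0) :
    ∃ (K : Submodule ℂ (Fin n × Fin n → ℂ)) (k : ℕ),
      (∀ x v : Fin n × Fin n → ℂ, v ∈ K →
        ∃ (g : (Matrix (Fin m) (Fin m) ℂ)ˣ) (lvl : Fin m → ℕ) (p r a : ℕ),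
          (∀ i, lvl i < p) ∧ (p - 1 + r * (n - 1)) / (a + 1) ≤ k ∧
          ∀ (i j : Fin m) (d : Fin 1 →₀ ℕ),
            coeff d (((g : Matrix (Fin m) (Fin m) ℂ).map C *
              N.map (aeval fun c => (C (x c) + ∑ t : Fin 1, C (v c) * X t : MvPolynomial (Fin 1) ℂ)) *
              (↑g⁻¹ : Matrix (Fin m) (Fin m) ℂ).map C : Matrix (Fin m) (Fin m) (MvPolynomial (Fin 1) ℂ)) i j) ≠ 0 →
              (a + 1) * d 0 + lvl j ≤ lvl i + r) ∧
      (k + 1) * n < Module.finrank ℂ K := by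
  refine flagCheap_of_top_pow_eq_zero N hN ⊤ ν hν (fun v _ => htop v) ?_
  rw [finrank_top, Module.finrank_fintype_fun_eq_card, Fintype.card_prod, Fintype.card_fin]
  have hlt : (ν - 1) * n / ν < n - 1 := by
    rw [Nat.div_lt_iff_lt_mul (by omega)]
    have e1 : (ν - 1) * n = ν * n - n := Nat.sub_one_mul ν n
    have e2 : (n - 1) * ν = ν * n - ν := by rw [Nat.sub_one_mul, Nat.mul_comm]
    have e3 : n ≤ ν * n := Nat.le_mul_of_pos_left n (by omega)
    rw [e1, e2]; omega
  have hle : (ν - 1) * n / ν + 1 ≤ n - 1 := hlt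
  calc ((ν - 1) * n / ν + 1) * n ≤ (n - 1) * n := Nat.mul_le_mul_right n hle
    _ < n * n := by
      apply Nat.mul_lt_mul_of_pos_right (by omega) (by omega)

end Summit.ValiantsHypothesis.ValiantsHypothesis.Theorems.DualUnipotentThreeHalvesNegative.FlagCost
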